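import Summits.Ventures.QEC.Census.CertCoverBatch
import Summits.Ventures.QEC.Census.BB.A1s_n180_k4_0383c42c.CoreDefs
import HarnessLib

set_option Elab.async false
set_option maxRecDepth 200000

/-!
# `[[180,4,18]]` one-level cover certificate — LEVEL-1→0 coset problems 1582…1605 (problem 3 excluded: `ProbDeep.lean`) as COMPACT data
(`ProbData`: U, f, σ, y₀, allow; qec-type-10 `CertCoverBatch.mkCoset` rebuilds each `CosetProb` in the kernel) + their verdict
`probsOK cov covR hx hx1 D1 lxd 16` (one `decide +kernel`; 24 problems, depths f=0:23 f=1:1 f=2:0 f=3:0, est. 55 s).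
qec-search-9 g6 (pattern of search-9 g5 `Probs*`); data from JSON `level10.problems` (sha256 f0ac2553…). Data + decided check; KERNEL.
-/

namespace Summit.Ventures.QEC.Census.A1s_n180_k4_0383c42c

open Matrix Summit.Ventures.QEC.Census Literature.InformationTheory.QuantumCodes

/-- Problems 1582…1605 (24): `⟨U, f, σ, y₀, allow⟩`. -/
def probs32 : List ProbData := [
    ⟨6201408129394787471196289, 0, 38815797640, 6044629242188334083958640, []⟩,
    ⟨7279825473258278875037700, 0, 210528962965, 7253557233136117909594616, []⟩,
    ⟨7414191509240430391988609, 0, 212869649856, 76095071123219500799, []⟩,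
    ⟨7594193074752449245437986, 0, 233154093219, 2456257760390807703109634, []⟩,
    ⟨9748295205099158131179520, 0, 4812689187521, 75708031751889579676422, []⟩,
    ⟨9748297507564467544654016, 0, 4812617949857, 9672587166591869245723590, []⟩,
    ⟨9749787963741103281217541, 0, 17869292807236, 9749640351507921070196738, []⟩,
    ⟨9761445422428195446063168, 0, 328710234729, 80594114531024297657345, []⟩,
    ⟨9768290028401235106791560, 0, 4400833725083, 9765928845124615914750872, []⟩,
    ⟨9770615750226372342055424, 0, 2483430695697, 75558160998676519207832, []⟩,
    ⟨9785225312029307742199813, 0, 18974105478212, 186811564347441031175, []⟩,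
    ⟨9823740081389659557462080, 0, 2203566744289, 9672624352774273940470848, []⟩,
    ⟨9823742100550404912185352, 0, 2203487634117, 9822561508648212528512128, []⟩,
    ⟨9823742388358568606695424, 1, 2203495506625, 9822561796737851199732864, []⟩,
    ⟨9823744690823878028558528, 0, 2203424268961, 1185203306735985638592, []⟩,
    ⟨9823746705481023772688520, 0, 2203361936005, 43811019649238602614, []⟩,
    ⟨9828132459555759339864073, 0, 830228989592, 156430713603024215871495, []⟩,
    ⟨9846173339795107189096456, 0, 1937715036841, 4759264475175105303510, []⟩,
    ⟨9899337145570568767012864, 0, 144057639617, 227927987824338102038518, []⟩,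
    ⟨9995073445974468093542464, 0, 1451804861185, 2509047676270292324990, []⟩,
    ⟨10032833931092183315644480, 0, 284648022785, 323629975301937350092285, []⟩,
    ⟨10389983369723110001483781, 0, 299579286596, 777107374706163460103, []⟩,
    ⟨12167329738410045191749826, 0, 483257361059, 78071524214033189704454, []⟩,
    ⟨19656338670023829847410704, 0, 1658176143665, 311680800682414572795953, []⟩]

set_option maxHeartbeats 400000000 in
/-- Every problem of this chunk passes (`mkCoset` elimination + `cosetOKD` + fast `σ` + depth + `BU`-evenness + label checks). -/
theorem probs32_ok : probsOK A1s_n180_k4_0383c42c.cov A1s_n180_k4_0383c42c.covR A1s_n180_k4_0383c42c.hx A1s_n180_k4_0383c42c.hx1 A1s_n180_k4_0383c42c.D1 A1s_n180_k4_0383c42c.lxd 16 A1s_n180_k4_0383c42c.probs32 = true := by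
  decide +kernel

/-- Pointwise form. -/
theorem probs32_all : ∀ x ∈ A1s_n180_k4_0383c42c.probs32, probOK A1s_n180_k4_0383c42c.cov A1s_n180_k4_0383c42c.covR A1s_n180_k4_0383c42c.hx A1s_n180_k4_0383c42c.hx1 A1s_n180_k4_0383c42c.D1 A1s_n180_k4_0383c42c.lxd 16 x = true := by
  have h := probs32_ok
  rwa [probsOK, List.all_eq_true] at h

end Summit.Ventures.QEC.Census.A1s_n180_k4_0383c42c
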